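import Summits.Ventures.GridStability.Models.WSCC9FaultOnTube
import Literature.Computability.MetaComplexity.TaylorCosineMinorants

/-!
# WSCC9FaultOnTrigEnclosure — rational `sin`/`cos` enclosures and the JOINT monotonicity of the bus-7 fault-on couplings (part 1 of the N-leg kernel tube integrator)

Venture GRIDFUSION (LADDER-GRIDFUSION G1-cct, «#61⁗»-successor input; seat gridfusion-model-1 g6).  Part 1 of 3
(`WSCC9FaultOnTrigEnclosure` → `WSCC9FaultOnTubeLegs` → `WSCC9FaultOnTubeChain`; data `WSCC9FaultOnTubeLegs36`): the scalar
ingredients that make every hypothesis of Moore's a-priori enclosure a RATIONAL inequality.  §1 `sinLo/sinHi/cosLo/cosHi` — the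
degree-7/5 and 6/4 Taylor polynomials over `ℚ` with `sinLo x ≤ sin x ≤ sinHi x` (`x ≥ 0`), `cosLo x ≤ cos x ≤ cosHi x` (all `x`), from
the tree's global alternating bounds `Literature.Computability.MetaComplexity.sinTaylorSum_le_sin` & co.; §2 the fault-on coupling
constants of `faultBus7_Pe_zero/two` (`Cc = C₁₃ = 0.677570171284`, `Dd = D₁₃ = 0.075376559101`, `G11 = E₁²G₁₁`, `G33 = E₃²G₃₃`) and
the monotonicity of `f(a) = Cc sin a + Dd cos a` and `g(a) = Cc sin a − Dd cos a` on `[0, 7/5]` (`f_mono`, `g_mono`: the range of the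
coupling over an angle interval is attained at its ENDPOINTS — the «joint» bound that the 3-leg chain p510936/p524020 did not use);
§3 two isotonicity lemmas for Moore's inclusions (`min 0 (wlo τ) ≤ min 0 (w s)`, `max 0 (w s) ≤ max 0 (whi τ)` for `wlo ≤ w ≤ whi`,
`0 ≤ s ≤ τ`).  No model sentence here.  [cite: Moore1979, §8.1 eqs. (8.5), (8.10); AndersonFouad1977, Example 2.6 / §2.10]
-/

noncomputable section

open Real Set Finset

namespace Summit.Ventures.GridStability.Models

namespace WSCC9

namespace FaultOnLeg

/-! ### §1 Rational Taylor enclosures of `sin` and `cos` (global alternating bounds, tree `TaylorCosineMinorants`) -/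

/-- `S₃(x) = x − x³/6 + x⁵/120 − x⁷/5040` (lower bound of `sin x` for `x ≥ 0`). -/
def sinLo (x : ℚ) : ℚ := x - x ^ 3 / 6 + x ^ 5 / 120 - x ^ 7 / 5040

/-- `S₂(x) = x − x³/6 + x⁵/120` (upper bound of `sin x` for `x ≥ 0`). -/
def sinHi (x : ℚ) : ℚ := x - x ^ 3 / 6 + x ^ 5 / 120

/-- `T₃(x) = 1 − x²/2 + x⁴/24 − x⁶/720` (lower bound of `cos x`, every real `x`). -/
def cosLo (x : ℚ) : ℚ := 1 - x ^ 2 / 2 + x ^ 4 / 24 - x ^ 6 / 720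

/-- `T₂(x) = 1 − x²/2 + x⁴/24` (upper bound of `cos x`, every real `x`). -/
def cosHi (x : ℚ) : ℚ := 1 - x ^ 2 / 2 + x ^ 4 / 24

/-- `S₃(x) ≤ sin x` for rational `x ≥ 0`. [folklore] -/
theorem sinLo_le {x : ℚ} (hx : 0 ≤ x) : ((sinLo x : ℚ) : ℝ) ≤ Real.sin x := by
  have h := Literature.Computability.MetaComplexity.sinTaylorSum_le_sin (M := 3) ⟨1, by norm_num⟩
    (y := (x : ℝ)) (by exact_mod_cast hx)
  simp only [Finset.sum_range_succ, Finset.sum_range_zero] at h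
  norm_num [Nat.factorial] at h
  push_cast [sinLo]
  linarith [h]

/-- `sin x ≤ S₂(x)` for rational `x ≥ 0`. [folklore] -/
theorem le_sinHi {x : ℚ} (hx : 0 ≤ x) : Real.sin x ≤ ((sinHi x : ℚ) : ℝ) := by
  have h := Literature.Computability.MetaComplexity.sin_le_sinTaylorSum (M := 2) ⟨1, by norm_num⟩
    (y := (x : ℝ)) (by exact_mod_cast hx)
  simp only [Finset.sum_range_succ, Finset.sum_range_zero] at h
  norm_num [Nat.factorial] at h
  push_cast [sinHi]
  linarith [h]

/-- `T₃(x) ≤ cos x` for rational `x`. [folklore] -/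
theorem cosLo_le (x : ℚ) : ((cosLo x : ℚ) : ℝ) ≤ Real.cos x := by
  have h := Literature.Computability.MetaComplexity.cosTaylorSum_le_cos (M := 3) ⟨1, by norm_num⟩ (x : ℝ)
  simp only [Finset.sum_range_succ, Finset.sum_range_zero] at h
  norm_num [Nat.factorial] at h
  push_cast [cosLo]
  linarith [h]

/-- `cos x ≤ T₂(x)` for rational `x`. [folklore] -/
theorem le_cosHi (x : ℚ) : Real.cos x ≤ ((cosHi x : ℚ) : ℝ) := by
  have h := Literature.Computability.MetaComplexity.cos_le_cosTaylorSum (M := 2) ⟨1, by norm_num⟩ (x : ℝ)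
  simp only [Finset.sum_range_succ, Finset.sum_range_zero] at h
  norm_num [Nat.factorial] at h
  push_cast [cosHi]
  linarith [h]

/-! ### §2 The fault-on couplings of machines 1 and 3 and their joint monotonicity -/

/-- `C₁₃ = E₁E₃B₁₃ = 0.677570171284` of the faulted network (the `sin` coefficient of `faultBus7_Pe_zero/two`). -/
def Cc : ℚ := 169392542821 / 250000000000

/-- `D₁₃ = E₁E₃G₁₃ = 0.075376559101` of the faulted network (the `cos` coefficient of `faultBus7_Pe_zero/two`). -/
def Dd : ℚ := 75376559101 / 1000000000000

/-- `E₁²G₁₁ = 0.733233515479` of the faulted network (`faultBus7_Pe_zero`). -/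
def G11 : ℚ := 733233515479 / 1000000000000

/-- `E₃²G₃₃ = 0.179988582327` of the faulted network (`faultBus7_Pe_two`). -/
def G33 : ℚ := 179988582327 / 1000000000000

/-- On `[0, 7/5]`: `Cc·cos m − Dd·sin m ≥ 0` (the derivative sign behind `f_mono`; `cos(7/5) ≥ T₃(7/5) ≈ 0.1696`,
`0.6776 · 0.1696 > 0.0754`). -/
theorem Cc_cos_sub_Dd_sin_nonneg {m : ℝ} (h0 : 0 ≤ m) (h1 : m ≤ 7 / 5) :
    0 ≤ (Cc : ℝ) * Real.cos m - Dd * Real.sin m := by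
  have hπ := Real.pi_gt_three
  have hc : Real.cos (7 / 5) ≤ Real.cos m := Real.cos_le_cos_of_nonneg_of_le_pi h0 (by linarith) h1
  have hc0 := cosLo_le (7 / 5)
  have hs : Real.sin m ≤ 1 := Real.sin_le_one m
  norm_num [cosLo, Cc, Dd] at hc0 ⊢
  nlinarith [hc, hc0, hs]

/-- **`f(a) = Cc sin a + Dd cos a` is monotone on `[0, 7/5]`** (enters `P^F_{e,3}`): for `0 ≤ x ≤ y ≤ 7/5`,
`f x ≤ f y` (`f y − f x = 2 sin((y−x)/2)·(Cc cos((y+x)/2) − Dd sin((y+x)/2))`). -/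
theorem f_mono {x y : ℝ} (hx : 0 ≤ x) (hxy : x ≤ y) (hy : y ≤ 7 / 5) :
    (Cc : ℝ) * Real.sin x + Dd * Real.cos x ≤ Cc * Real.sin y + Dd * Real.cos y := by
  have hπ := Real.pi_gt_three
  have h1 : Real.sin y - Real.sin x = 2 * Real.sin ((y - x) / 2) * Real.cos ((y + x) / 2) :=
    Real.sin_sub_sin y x
  have h2 : Real.cos y - Real.cos x = -2 * Real.sin ((y + x) / 2) * Real.sin ((y - x) / 2) :=
    Real.cos_sub_cos y x
  have hs : 0 ≤ Real.sin ((y - x) / 2) :=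
    Real.sin_nonneg_of_nonneg_of_le_pi (by linarith) (by linarith)
  have hk := Cc_cos_sub_Dd_sin_nonneg (m := (y + x) / 2) (by linarith) (by linarith)
  have key : (Cc : ℝ) * Real.sin y + Dd * Real.cos y - (Cc * Real.sin x + Dd * Real.cos x) =
      2 * Real.sin ((y - x) / 2) * ((Cc : ℝ) * Real.cos ((y + x) / 2) - Dd * Real.sin ((y + x) / 2)) := by
    have e1 : (Cc : ℝ) * Real.sin y + Dd * Real.cos y - (Cc * Real.sin x + Dd * Real.cos x) =
        Cc * (Real.sin y - Real.sin x) + Dd * (Real.cos y - Real.cos x) := by ring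
    rw [e1, h1, h2]; ring
  nlinarith [mul_nonneg hs hk, key]

/-- **`g(a) = Cc sin a − Dd cos a` is monotone on `[0, 7/5]`** (enters `−P^F_{e,1}`): for `0 ≤ x ≤ y ≤ 7/5`, `g x ≤ g y`. -/
theorem g_mono {x y : ℝ} (hx : 0 ≤ x) (hxy : x ≤ y) (hy : y ≤ 7 / 5) :
    (Cc : ℝ) * Real.sin x - Dd * Real.cos x ≤ Cc * Real.sin y - Dd * Real.cos y := by
  have hπ := Real.pi_gt_three
  have h1 : Real.sin y - Real.sin x = 2 * Real.sin ((y - x) / 2) * Real.cos ((y + x) / 2) :=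
    Real.sin_sub_sin y x
  have h2 : Real.cos y - Real.cos x = -2 * Real.sin ((y + x) / 2) * Real.sin ((y - x) / 2) :=
    Real.cos_sub_cos y x
  have hs : 0 ≤ Real.sin ((y - x) / 2) :=
    Real.sin_nonneg_of_nonneg_of_le_pi (by linarith) (by linarith)
  have hc : 0 ≤ Real.cos ((y + x) / 2) :=
    Real.cos_nonneg_of_neg_pi_div_two_le_of_le (by linarith) (by linarith)
  have hs2 : 0 ≤ Real.sin ((y + x) / 2) :=
    Real.sin_nonneg_of_nonneg_of_le_pi (by linarith) (by linarith)
  have hCc : (0 : ℝ) ≤ Cc := by norm_num [Cc]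
  have hDd : (0 : ℝ) ≤ Dd := by norm_num [Dd]
  have key : (Cc : ℝ) * Real.sin y - Dd * Real.cos y - (Cc * Real.sin x - Dd * Real.cos x) =
      2 * Real.sin ((y - x) / 2) * ((Cc : ℝ) * Real.cos ((y + x) / 2) + Dd * Real.sin ((y + x) / 2)) := by
    have e1 : (Cc : ℝ) * Real.sin y - Dd * Real.cos y - (Cc * Real.sin x - Dd * Real.cos x) =
        Cc * (Real.sin y - Real.sin x) - Dd * (Real.cos y - Real.cos x) := by ring
    rw [e1, h1, h2]; ring
  have hk : 0 ≤ (Cc : ℝ) * Real.cos ((y + x) / 2) + Dd * Real.sin ((y + x) / 2) :=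
    add_nonneg (mul_nonneg hCc hc) (mul_nonneg hDd hs2)
  nlinarith [mul_nonneg hs hk, key]
/-! ### §3 Isotonicity of Moore's inclusions in the step -/

/-- Isotonicity: `wlo ≤ w`, `0 ≤ s ≤ τ` ⇒ `min 0 (wlo τ) ≤ min 0 (w s)`. -/
theorem min_zero_mul_mono {wlo w s τ : ℝ} (hw : wlo ≤ w) (hs : 0 ≤ s) (hsτ : s ≤ τ) :
    min 0 (wlo * τ) ≤ min 0 (w * s) := by
  refine le_min (min_le_left _ _) ?_
  by_cases h : 0 ≤ w
  · exact le_trans (min_le_left _ _) (mul_nonneg h hs)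
  · have hw0 : w < 0 := not_le.1 h
    have h1 : w * τ ≤ w * s := mul_le_mul_of_nonpos_left hsτ hw0.le
    have h2 : wlo * τ ≤ w * τ := mul_le_mul_of_nonneg_right hw (hs.trans hsτ)
    exact le_trans (min_le_right _ _) (h2.trans h1)

/-- Isotonicity: `w ≤ whi`, `0 ≤ s ≤ τ` ⇒ `max 0 (w s) ≤ max 0 (whi τ)`. -/
theorem max_zero_mul_mono {whi w s τ : ℝ} (hw : w ≤ whi) (hs : 0 ≤ s) (hsτ : s ≤ τ) :
    max 0 (w * s) ≤ max 0 (whi * τ) := by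
  refine max_le (le_max_left _ _) ?_
  by_cases h : 0 ≤ w
  · have h1 : w * s ≤ w * τ := mul_le_mul_of_nonneg_left hsτ h
    have h2 : w * τ ≤ whi * τ := mul_le_mul_of_nonneg_right hw (hs.trans hsτ)
    exact le_trans (h1.trans h2) (le_max_right _ _)
  · exact le_trans (mul_nonpos_of_nonpos_of_nonneg (not_le.1 h).le hs) (le_max_left _ _)
end FaultOnLeg

end WSCC9

end Summit.Ventures.GridStability.Models

end
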